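import Literature.Probability.Percolation.TriangleSusceptibilityDerivative
import Literature.Barriers.CriticalPhenomena.GaussianDominationRouteNobleProofs
import Literature.Barriers.CriticalPhenomena.GaussianDominationRouteNobleAnalysis
import HarnessLib

/-!
# `θ(p) ≤ C (p - p_c)` for `d ≥ 11` (`FitznerVanDerHofstad2017_theta_le`): reduction of the named
# fact to the computer-assisted NoBLE bootstrap alone

Topic `Literature/Probability/Percolation`, family `crit-perc`. Sibling THEOREM-ONLY file of
`MeanFieldBeta.lean`, which isolates the upper half of Fitzner–van der Hofstad 2017, Cor. 1.3 /
(1.6) with `β = 1` — for nearest-neighbour bond percolation on `ℤ^d`, `d ≥ 11`, there is `C` with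
`θ(p) ≤ C (p - p_c)` for all `p ≥ p_c` — as the named fact
`Literature.Probability.Percolation.FitznerVanDerHofstad2017_theta_le`, and proves it EQUIVALENT
to the full two-sided statement `FitznerVanDerHofstad2017_beta_eq_one`
(`fitznerVanDerHofstad2017_beta_eq_one_iff_theta_le`; the lower half `p - p_c ≤ θ(p)` holds in
every `d ≥ 2`, `sub_criticalProb_le_theta`).

The printed proof of Cor. 1.3 (§1.3, the paragraph preceding it) is: Thm. 1.1 (the infrared bound,
uniform in `p < p_c`, `d ≥ 11`) ⟹ the triangle condition `Δ(p_c) < ∞` ⟹ ("In [BarAiz91], it was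
shown that, under the same condition, `β = 1` … in the bounded-ratio sense") the two-sided linear
bound (1.6). Every step of this chain is by now a theorem of this library, in files that no single
earlier module imports together:

* Barsky–Aizenman's implication `BarskyAizenman1991_beta_of_triangle_holds`
  (`TriangleSusceptibilityDerivative.lean`, through `γ = 1` under the triangle condition —
  Aizenman–Newman, Grimmett Thm. (10.61), `AizenmanNewman1984_gamma_eq_one_holds` — and
  Hutchcroft 2022, Thm. 1.3, `Hutchcroft2022_thm13_holds`), whence
  `FitznerVanDerHofstad2017_beta_eq_one_of_nobleBound'`: the target from the NoBLE bound alone;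
* infrared bound ⟹ triangle condition for `d ≥ 11`
  (`FitznerVanDerHofstad2017_triangleCondition_of_infraredBound`, `InfraredBoundTriangle.lean`);
* the NoBLE bound `FitznerVanDerHofstad2017_nobleBound` ([FitHof13b] Thm. 2.10, first bound) —
  hence Thm. 1.1, `FitznerVanDerHofstad2017_infraredBound` — from Fitzner–van der Hofstad 2017,
  Prop. 2.4 with its initialisation ALONE (`FitznerVanDerHofstad2017_nobleBound_of_prop24'`,
  `FitznerVanDerHofstad2017_infraredBound_of_prop24'`, `GaussianDominationRouteNobleProofs.lean`:
  the continuity claims (i) of §2.4, incl. [FitHof13b] Lemma 3.5, are proved there), and Prop. 2.4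
  in turn from the inputs of the NoBLE analysis (`FitznerVanDerHofstad2017_prop24_of_nobleAnalysisInputs`,
  `GaussianDominationRouteNobleAnalysis.lean`: [FitHof13b] Lemmas 3.1, 3.2, 3.4 proved).

This file composes them: `FitznerVanDerHofstad2017_theta_le` (and the two-sided
`FitznerVanDerHofstad2017_beta_eq_one`, the triangle condition for `d ≥ 11`, and `θ(p_c) = 0` for
`d ≥ 11`) follow from the SINGLE named fact
`Literature.Barriers.CriticalPhenomena.FitznerVanDerHofstad2017_prop24` — the computer-assisted
core of Thm. 1.1 (NoBLE derivation Prop. 2.1, diagrammatic bounds Prop. 2.2, [FitHof13b] §3 and the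
rigorous numerics of the three Mathematica notebooks), which is NOT formalised — equivalently from
`FitznerVanDerHofstad2017_nobleAnalysisInputs` one level below it. The discharge
`FitznerVanDerHofstad2017_theta_le_holds` is `FitznerVanDerHofstad2017_theta_le_of_prop24` applied
to a proof of that fact. Also recorded: the dimension-wise content of Heydenreich–van der Hofstad
2017, Thm. 4.1 (upper bound) — in any `d ≥ 2` satisfying the triangle condition,
`θ(p) ≤ C (p - p_c)` for all `p ≥ p_c`, unconditionally (`theta_le_of_triangleCondition`) — and the
corollary `θ(p_c) = 0` of the fact itself (`FitznerVanDerHofstad2017_theta_le.percolationContinuity`).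
No definitions, no new named facts.

## References

* R. Fitzner, R. van der Hofstad, *Mean-field behavior for nearest-neighbor percolation in
  `d > 10`*, Electron. J. Probab. 22 (2017) no. 43 (arXiv:1506.07977): §1.2 (1.5)–(1.6), §1.3
  Thm. 1.1, Cor. 1.3 and the paragraph preceding it ([AizNew84], [BarAiz91]), §2.4 (claims
  (i)–(iii)), Prop. 2.4, §2.5–§2.6.
* R. Fitzner, R. van der Hofstad, *Generalized approach to the non-backtracking lace expansion*,
  Probab. Theory Relat. Fields 169 (2017) 1041–1119 ([FitHof13b]): Thm. 2.10, Prop. 2.11, §3.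
* M. Heydenreich, R. van der Hofstad, *Progress in High-Dimensional Percolation and Random Graphs*,
  Springer 2017: (1.2.3), Thm. 4.1, Thm. 9.5 (9.3.1), Thm. 10.1.
* D. J. Barsky, M. Aizenman, Ann. Probab. 19 (1991) 1520–1536; M. Aizenman, C. M. Newman, J. Stat.
  Phys. 36 (1984) 107–143; T. Hutchcroft, J. Stat. Phys. 189 (2022) no. 6, Thm. 1.3;
  G. Grimmett, *Percolation*, 2nd ed. (1999), §10.3 Thm. (10.52)–(10.53), Thm. (10.61).
-/

namespace Literature.Probability.Percolation

open Literature.Probability.LatticeModels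
open Literature.Barriers.CriticalPhenomena

variable {d : ℕ}

/-! ### The dimension-wise statement under the triangle condition, and the corollary `θ(p_c) = 0` -/

/-- **Heydenreich–van der Hofstad 2017, Thm. 4.1 (upper bound in (1.2.3)), unconditionally**: in any
dimension `d ≥ 2` in which the triangle condition holds there is `C` with `θ(p) ≤ C (p - p_c)` for
all `p ≥ p_c` (Barsky–Aizenman; here through `betaEqOneBoundedRatio_of_triangle`, i.e. `γ = 1` and
Hutchcroft's Thm. 1.3, globalised by `θ ≤ 1`).
[cite: HeydenreichVanDerHofstad2017, Thm. 4.1 with (1.2.3) (upper inequality)] -/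
theorem theta_le_of_triangleCondition (hd : 2 ≤ d) (hT : TriangleCondition d) :
    ∃ C : ℝ, ∀ p : unitInterval, criticalProb (zdGraph d) (0 : Site d) ≤ p →
      theta (zdGraph d) 0 p ≤ C * ((p : ℝ) - criticalProb (zdGraph d) 0) := by
  obtain ⟨c₁, c₂, -, -, hb⟩ := betaEqOneBoundedRatio_of_triangle hd hT
  exact ⟨c₂, fun p hp => (hb p hp).2⟩

/-- **Corollary of the fact** (`θ(p_c) = 0` for `d ≥ 11`): at `p = p_c` the bound reads
`θ(p_c) ≤ C · 0 = 0`, and `θ ≥ 0`; hence `PercolationContinuity d` for every `d ≥ 11`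
("continuity of `p ↦ θ(p)` is equivalent to the statement that `θ(p_c(d)) = 0`").
[cite: FitznerVanDerHofstad2017, §1.2 (continuity of θ ⇔ θ(p_c) = 0) and Cor. 1.3] -/
theorem FitznerVanDerHofstad2017_theta_le.percolationContinuity
    (h : FitznerVanDerHofstad2017_theta_le) (hd : 11 ≤ d) : PercolationContinuity d :=
  (fitznerVanDerHofstad2017_beta_eq_one_iff_theta_le.2 h).percolationContinuity hd

/-! ### The fact from the NoBLE bound, from Prop. 2.4, and from the inputs of the NoBLE analysis -/

/-- **`FitznerVanDerHofstad2017_theta_le` from the NoBLE bound alone**: the upper half of Cor. 1.3 /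
(1.6) follows from the single named fact `FitznerVanDerHofstad2017_nobleBound` ([FitHof13b]
Thm. 2.10, first bound, for percolation in `d ≥ 11`), every other printed step (NoBLE bound ⟹
infrared bound ⟹ triangle condition ⟹ `γ = 1` ⟹ `β = 1`) being a theorem of this library
(`FitznerVanDerHofstad2017_beta_eq_one_of_nobleBound'`).
[cite: FitznerVanDerHofstad2017, Cor. 1.3 and (1.6) (upper inequality); §2.1] -/
theorem FitznerVanDerHofstad2017_theta_le_of_nobleBound (hN : FitznerVanDerHofstad2017_nobleBound) :
    FitznerVanDerHofstad2017_theta_le :=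
  fitznerVanDerHofstad2017_beta_eq_one_iff_theta_le.1 (FitznerVanDerHofstad2017_beta_eq_one_of_nobleBound' hN)

/-- **Cor. 1.3, first assertion, from Prop. 2.4 alone**: the triangle condition for every `d ≥ 11`
follows from the computer-assisted bootstrap `FitznerVanDerHofstad2017_prop24` (Prop. 2.4 with its
initialisation), through Thm. 1.1 (`FitznerVanDerHofstad2017_infraredBound_of_prop24'`) and
"the infrared bound … immediately implies that the triangle condition holds"
(`FitznerVanDerHofstad2017_triangleCondition_of_infraredBound`).
[cite: FitznerVanDerHofstad2017, Cor. 1.3 (first assertion), Thm. 1.1 and Prop. 2.4] -/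
theorem FitznerVanDerHofstad2017_triangleCondition_of_prop24 (h24 : FitznerVanDerHofstad2017_prop24) :
    FitznerVanDerHofstad2017_triangleCondition :=
  FitznerVanDerHofstad2017_triangleCondition_of_infraredBound
    (FitznerVanDerHofstad2017_infraredBound_of_prop24' h24)

/-- **Cor. 1.3 (`β = 1` for `d ≥ 11`, two-sided) from Prop. 2.4 alone**: the named fact
`FitznerVanDerHofstad2017_beta_eq_one` follows from the computer-assisted bootstrap
`FitznerVanDerHofstad2017_prop24`, via `FitznerVanDerHofstad2017_nobleBound_of_prop24'` (claims (i)
of §2.4 and [FitHof13b] Lemma 2.1 / Prop. 2.11 ⟹ Thm. 2.10 being formal) and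
`FitznerVanDerHofstad2017_beta_eq_one_of_nobleBound'`. Its trust base is therefore exactly
{`FitznerVanDerHofstad2017_prop24`}. [cite: FitznerVanDerHofstad2017, Cor. 1.3 with (1.6), Thm. 1.1 and Prop. 2.4] -/
theorem FitznerVanDerHofstad2017_beta_eq_one_of_prop24 (h24 : FitznerVanDerHofstad2017_prop24) :
    FitznerVanDerHofstad2017_beta_eq_one :=
  FitznerVanDerHofstad2017_beta_eq_one_of_nobleBound' (FitznerVanDerHofstad2017_nobleBound_of_prop24' h24)

/-- **`FitznerVanDerHofstad2017_theta_le` from Prop. 2.4 alone**: the upper half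
`θ(p) ≤ C (p - p_c)` (`p ≥ p_c`, `d ≥ 11`) of Cor. 1.3 / (1.6) follows from the computer-assisted
bootstrap `FitznerVanDerHofstad2017_prop24`; the discharge `FitznerVanDerHofstad2017_theta_le_holds`
is this theorem applied to a proof of that fact.
[cite: FitznerVanDerHofstad2017, Cor. 1.3 and (1.6) (upper inequality), Thm. 1.1 and Prop. 2.4] -/
theorem FitznerVanDerHofstad2017_theta_le_of_prop24 (h24 : FitznerVanDerHofstad2017_prop24) :
    FitznerVanDerHofstad2017_theta_le :=
  FitznerVanDerHofstad2017_theta_le_of_nobleBound (FitznerVanDerHofstad2017_nobleBound_of_prop24' h24)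

/-- `θ(p_c) = 0` (`PercolationContinuity d`) for every `d ≥ 11`, conditionally on Prop. 2.4 only.
[cite: FitznerVanDerHofstad2017, §1.2 (continuity of θ ⇔ θ(p_c) = 0), Cor. 1.3 and Prop. 2.4] -/
theorem percolationContinuity_of_prop24 (h24 : FitznerVanDerHofstad2017_prop24) (hd : 11 ≤ d) :
    PercolationContinuity d :=
  (FitznerVanDerHofstad2017_beta_eq_one_of_prop24 h24).percolationContinuity hd

/-- **`FitznerVanDerHofstad2017_theta_le` from the inputs of the NoBLE analysis** (one level below
Prop. 2.4: the simplified NoBLE form with the Assumption 2.7 bounds, the `f₃`-improvement and the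
numerical conditions of [FitHof13b] Def. 2.9, `FitznerVanDerHofstad2017_nobleAnalysisInputs`), via
`FitznerVanDerHofstad2017_prop24_of_nobleAnalysisInputs` ([FitHof13b] Lemmas 3.2, 3.4 proved).
[cite: FitznerVanDerHofstad2017, Cor. 1.3 and Prop. 2.4] [cite: FitznerVanDerHofstad2016NoBLE, Prop. 2.11 (proof in §3)] -/
theorem FitznerVanDerHofstad2017_theta_le_of_nobleAnalysisInputs
    (h : FitznerVanDerHofstad2017_nobleAnalysisInputs) : FitznerVanDerHofstad2017_theta_le :=
  FitznerVanDerHofstad2017_theta_le_of_prop24 (FitznerVanDerHofstad2017_prop24_of_nobleAnalysisInputs h)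

/-- **Cor. 1.3, first assertion, from the inputs of the NoBLE analysis** (one level below
Prop. 2.4): the triangle condition for every `d ≥ 11` follows from the single named fact
`FitznerVanDerHofstad2017_nobleAnalysisInputs` (the simplified NoBLE form with the
Assumption 2.7 bounds, the `f₃`-improvement and the numerical conditions of [FitHof13b]
Def. 2.9, verified by the notebooks of §2.5), via
`FitznerVanDerHofstad2017_prop24_of_nobleAnalysisInputs` ([FitHof13b] Lemmas 3.2, 3.4 proved),
Thm. 1.1 (`FitznerVanDerHofstad2017_infraredBound_of_prop24'`) and
`FitznerVanDerHofstad2017_triangleCondition_of_infraredBound` (Parseval,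
`Δ(p_c) = lim_{p↗p_c} ∫ τ̂_p³`, uniformity of the infrared bound in `p < p_c`). The trust base
of the discharge `FitznerVanDerHofstad2017_triangleCondition_holds` is therefore exactly
{`FitznerVanDerHofstad2017_nobleAnalysisInputs`} — the NOT formalised, computer-assisted core
of Thm. 1.1.
[cite: FitznerVanDerHofstad2017, Cor. 1.3 (first assertion) and the paragraph preceding it, Thm. 1.1, Prop. 2.4]
[cite: FitznerVanDerHofstad2016NoBLE, Prop. 2.11 (proof in §3)] -/
theorem FitznerVanDerHofstad2017_triangleCondition_of_nobleAnalysisInputs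
    (h : FitznerVanDerHofstad2017_nobleAnalysisInputs) :
    FitznerVanDerHofstad2017_triangleCondition :=
  FitznerVanDerHofstad2017_triangleCondition_of_prop24
    (FitznerVanDerHofstad2017_prop24_of_nobleAnalysisInputs h)

end Literature.Probability.Percolation
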